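import Summits.BirchSwinnertonDyer.Rank1Residual.Supersingular.KuriharaTwistSymbolKurihara
import Summits.BirchSwinnertonDyer.Rank1Residual.GaloisImage.MazurTateTaylorCoeffTwist
import HarnessLib

/-!
# `hlow` is a theorem: the LOWER Taylor coefficients of the Mazur–Tate element at a Kolyvagin level vanish
# (cell `b2b-bsdres`, team n1011, ROUTE-1 §37.2 (c′)/§38, OWNERS row R1-64, seat p09 GEN 8; content = r1 GEN 26's
# kernel-checked scratch `cells/n1011/route1/g26_hlow.lean` 0020257a444dbc04, landed by the lead's R5-72 ADD 3)

HONEST FRAMING (cell `b2b-bsdres`, run/shared/lean/b2b/bsd-rank1-residual/, verbatim in every file): the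
goal of the cell is to DELETE the COMBINATION-SHAPED residual classes of the Birch–Swinnerton-Dyer formula
for ALL analytic-rank `≤ 1` elliptic curves over `ℚ` — "full BSD formula for every rank `≤ 1` curve in
class `C`" assembled STRICTLY from published theorems — so that the rank-`≤ 1` remainder becomes exactly the
CONSTRUCTION-SHAPED classes, which are TYPED (missing-input `Prop`s), NOT attempted. This is not "finishing
BSD". Team n1011 (N10/N11; ROUTE 1, the PORT anatomy (P-KIM) of class X4 ∧ `p = 3`): research route on
CONSTRUCTION-SHAPED classes; prove what is provable now; no claim beyond stated classes; census output =
EVIDENCE, never a Literature fact; RESIDUAL-MAP marks UNCHANGED; nothing is booked by this file. TOOL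
THEOREMS ONLY: no definition, no named fact, no `sorry`; tree inputs only.

## What

For a DISTRIBUTION SYSTEM with eigenvalue `2` (the tree's `KuriharaTwist.Identity.DistSystem`: norm relation
`Σ_b x_U(b, c) = 2·x_{U∖i}(c) − x_{U∖i}(g_i c) − x_{U∖i}(g_i⁻¹ c)`) and ADDITIVE characters `L_i : G_i → B`,
every coefficient `Σ_{a ∈ slice U} x_U(a)·Π_{l ∈ T} L_l(a_l)` with `T ⊊ U` is EXACTLY `0`
(`sum_slice_mul_prod_eq_zero_of_ssubset`; no ideal, no `ν < p`, no `2 ∈ Bˣ`; proof = the additive shadow of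
`D_mem_pow_succ`: remove `i ∈ U ∖ T` with the distribution relation, translation by `g_i^{±1}` shifts each
`L_l(c_l)` by `±L_l(g_{i,l})`, the `V = T` terms of the expansion over `V ⊆ T` cancel (`2 − 1 − 1`), the
`V ⊊ T` terms vanish by induction). On the tree's `symbolDist` (the plus symbol `[·]⁺_f` in CRT coordinates,
Hecke relation `intCast_mul_ratPlusSymbol`, eigenvalues `a_ℓ ≡ 2 (mod p^k)`), transported to `(ℤ/n)ˣ`
(`unitsEquivPi`), this gives `taylorCoeff_padicLift_eq_zero_of_ssubset[_of_isNewformOf]`: for the newform `f`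
of `E`, `p` odd, `E[p]` irreducible, `n ∈ 𝒩_k(E, p)` (`Kato.IsKolyvaginProduct W p k n`; only `p^k ∣ a_ℓ − 2`
is used, not `ℓ ≡ 1`), ANY discrete logarithms `ψ`, and a `p`-integral structure `Θ` of `θ̃_f(n)` (as in
`taylorCoeff_univ_eq_kuriharaNumber`), **every PROPER Taylor coefficient
`MazurTate.taylorCoeff (PadicInt.toZModPow k) (ψ_ℓ ∘ unitsMap) T Θ`, `T ⊊ univ`, is `0` in `ℤ/p^k`** — the
hypothesis `hlow` of the twist lemma (R1-63, `GaloisImage/MazurTateTaylorCoeffTwist.lean`) VERBATIM, i.e. the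
lower-coefficient content of C.-H. Kim, *Amer. J. Math.* (2026) = arXiv:2203.12159 §3.5's displayed
congruence `θ_{ℚ(μ_n)}(E) ≡ δ̃_n·∏(σ_{η_ℓ} − 1) mod (I_n, (σ − 1)², …)` (= K. Ota, *Amer. J. Math.* 140 (2018)
Prop. 2.3 (1) + Prop. 3.3) from TREE inputs only, for the tree's `modularElement` (period `Ω⁺_f`). The END
corollaries `taylorCoeff_univ_mul_padicLift_eq[_zero_iff]_of_isNewformOf` compose it with the twist lemma:
for EVERY `x ∈ ℤ_p[(ℤ/n)ˣ]`, `c_univ(x·Θ) = ε(x)·δ̃_n` in `ℤ/p^k`, `hlow`-FREE.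

`p = 3` NOTE (lead R5-72 ADD 3 / r1 §38): the multi-index `MazurTate.taylorCoeff` route used here has NO
restriction on `ν(n)` (the tree's bins identity `sum_units_ratModP_ratPlusSymbol_mul_choose_eq` needs
`ν(n) < p`, void at `p = 3` for `ν(n) ≥ 3` — deep-level consumers at `p = 3` read `δ̃` through `taylorCoeff`).
HONEST LIMITS: nothing about the TOP coefficient beyond `taylorCoeff_univ_eq_kuriharaNumber` (no
order-of-vanishing claim: Ota Thm. 5.17 / Kim Thm. 1.9 untouched); nothing about Kato's `a(A)`-system, (S-𝔊),
the PORT or DICT3 (r1's F-e stays provenance TEXT); the group-ring NORM RELATION (Ota Prop. 2.3 (1),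
n1011-p13's scratch) is a different theorem, not used here; closes nothing. References:
[Kim2022StructureSelmer] §3.5 (PDF p. 19); [Ota2018] Prop. 2.3 (1), Prop. 3.3, §5.1; [Kurihara2014] §1.1
(1)–(2); [MazurTateTeitelbaum1986Invent] §I.4 (4.2) (the Hecke relation, tree `intCast_mul_ratPlusSymbol`).
-/
open Finset

namespace Summit.BirchSwinnertonDyer.Rank1Residual.Supersingular.KuriharaTwist.Identity

section Additive

variable {ι : Type*} [Fintype ι] [DecidableEq ι]
variable {G : ι → Type*} [∀ i, CommGroup (G i)] [∀ i, Fintype (G i)] [∀ i, DecidableEq (G i)]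
variable {B : Type*} [CommRing B]

variable (S : DistSystem ι G B) (L : Π i, G i →* Multiplicative B)

/-- **Lower Taylor coefficients of a distribution system vanish**: for `T ⊊ U`, the ADDITIVE Taylor
coefficient of the level-`U` function indexed by `T`, `C(U, T) = Σ_{a ∈ slice U} x_U(a) · Π_{l ∈ T} L_l(a_l)`,
is `0` (strong induction on `#U`; r1 ROUTE-1 §38). [folklore] -/
theorem sum_slice_mul_prod_eq_zero_of_ssubset (U T : Finset ι) (hTU : T ⊂ U) :
    ∑ a ∈ slice U, S.x U a * ∏ l ∈ T, Multiplicative.toAdd (L l (a l)) = 0 := by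
  -- r1's `C U T`, as a local abbreviation
  let C : Finset ι → Finset ι → B := fun U T =>
    ∑ a ∈ slice U, S.x U a * ∏ l ∈ T, Multiplicative.toAdd (L l (a l))
  suffices key : ∀ (n : ℕ) (U T : Finset ι), U.card = n → T ⊂ U → C U T = 0 from
    key _ U T rfl hTU
  intro n
  induction n using Nat.strong_induction_on with
  | _ n ih =>
  intro U T hU hTU
  obtain ⟨i, hiU, hiT⟩ := Finset.exists_of_ssubset hTU
  set U' := U.erase i with hU'
  have hcard : U'.card = n - 1 := by rw [hU', Finset.card_erase_of_mem hiU, hU]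
  have hn : 1 ≤ n := by rw [← hU]; exact Finset.card_pos.2 ⟨i, hiU⟩
  have hTU' : T ⊆ U' := fun l hl => Finset.mem_erase.2 ⟨fun h => hiT (h ▸ hl), hTU.1 hl⟩
  -- abbreviations
  set x' := S.x U' with hx'
  set w : (Π i, G i) → B := fun a => ∏ l ∈ T, Multiplicative.toAdd (L l (a l)) with hw
  set gπ := proj U' (S.g i) with hgπ
  have hgπ_mem : gπ ∈ slice U' := proj_mem_slice U' (S.g i)
  have hgπ_inv_mem : gπ⁻¹ ∈ slice U' := by
    rw [mem_slice] at hgπ_mem ⊢; intro j hj; simp [hgπ_mem j hj]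
  -- step 1: split the sum at coordinate i and apply the distribution relation
  have step1 : C U T = ∑ c ∈ slice U', (2 * x' c - x' (S.g i * c) - x' ((S.g i)⁻¹ * c)) * w c := by
    simp only [C]
    rw [sum_slice_eq_sum_erase_update hiU]
    refine Finset.sum_congr rfl fun c hc => ?_
    have hwc : ∀ b : G i,
        (∏ l ∈ T, Multiplicative.toAdd (L l ((Function.update c i b) l))) = w c := by
      intro b
      simp only [hw]
      refine Finset.prod_congr rfl fun l hl => ?_
      have : l ≠ i := fun h => hiT (h ▸ hl)
      rw [Function.update_of_ne this]
    have : ∀ b ∈ (Finset.univ : Finset (G i)),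
        S.x U (Function.update c i b) * (∏ l ∈ T, Multiplicative.toAdd (L l ((Function.update c i b) l))) =
          S.x U (Function.update c i b) * w c := fun b _ => by rw [hwc b]
    rw [Finset.sum_congr rfl this, ← Finset.sum_mul, S.dist U i hiU c hc]
  -- step 2: move the translations from x' to w
  have hinvg : ∀ c : Π i, G i, x' (S.g i * c) = x' (gπ * c) := by
    intro c; apply S.inv; intro j hj; simp [hgπ, proj_apply_of_mem hj]
  have hinvg' : ∀ c : Π i, G i, x' ((S.g i)⁻¹ * c) = x' (gπ⁻¹ * c) := by
    intro c; apply S.inv; intro j hj; simp [hgπ, proj_apply_of_mem hj]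
  have step2a : ∑ c ∈ slice U', x' (S.g i * c) * w c = ∑ c ∈ slice U', x' c * w (gπ⁻¹ * c) := by
    calc ∑ c ∈ slice U', x' (S.g i * c) * w c
        = ∑ c ∈ slice U', (fun c => x' c * w (gπ⁻¹ * c)) (gπ * c) :=
          Finset.sum_congr rfl fun c _ => by
            show x' (S.g i * c) * w c = x' (gπ * c) * w (gπ⁻¹ * (gπ * c))
            rw [hinvg c, ← mul_assoc, inv_mul_cancel, one_mul]
      _ = ∑ c ∈ slice U', x' c * w (gπ⁻¹ * c) :=
          sum_slice_mul_left U' hgπ_mem (fun c => x' c * w (gπ⁻¹ * c))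
  have step2b : ∑ c ∈ slice U', x' ((S.g i)⁻¹ * c) * w c = ∑ c ∈ slice U', x' c * w (gπ * c) := by
    calc ∑ c ∈ slice U', x' ((S.g i)⁻¹ * c) * w c
        = ∑ c ∈ slice U', (fun c => x' c * w (gπ * c)) (gπ⁻¹ * c) :=
          Finset.sum_congr rfl fun c _ => by
            show x' ((S.g i)⁻¹ * c) * w c = x' (gπ⁻¹ * c) * w (gπ * (gπ⁻¹ * c))
            rw [hinvg' c, ← mul_assoc, mul_inv_cancel, one_mul]
      _ = ∑ c ∈ slice U', x' c * w (gπ * c) :=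
          sum_slice_mul_left U' hgπ_inv_mem (fun c => x' c * w (gπ * c))
  -- step 3: expand w(gπ^{±1} c) over subsets V ⊆ T (additivity of the characters)
  set v : ι → B := fun l => Multiplicative.toAdd (L l (S.g i l)) with hv
  set z : (Π i, G i) → ι → B := fun c l => Multiplicative.toAdd (L l (c l)) with hz
  have hwg : ∀ c : Π i, G i, w (gπ * c) =
      ∑ V ∈ T.powerset, (∏ l ∈ V, z c l) * ∏ l ∈ T \ V, v l := by
    intro c
    rw [← Finset.prod_add]
    simp only [hw]
    refine Finset.prod_congr rfl fun l hl => ?_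
    have hl' : l ∈ U' := hTU' hl
    simp only [Pi.mul_apply, hgπ, proj_apply_of_mem hl', map_mul, toAdd_mul, hv, hz]
    ring
  have hwg' : ∀ c : Π i, G i, w (gπ⁻¹ * c) =
      ∑ V ∈ T.powerset, (∏ l ∈ V, z c l) * ∏ l ∈ T \ V, (-v l) := by
    intro c
    rw [← Finset.prod_add]
    simp only [hw]
    refine Finset.prod_congr rfl fun l hl => ?_
    have hl' : l ∈ U' := hTU' hl
    simp only [Pi.mul_apply, Pi.inv_apply, hgπ, proj_apply_of_mem hl', map_mul, map_inv, toAdd_mul,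
      toAdd_inv, hv, hz]
    ring
  -- C U' V in terms of z
  have hCV : ∀ V : Finset ι, C U' V = ∑ c ∈ slice U', x' c * ∏ l ∈ V, z c l := by
    intro V; rfl
  have stepA : ∑ c ∈ slice U', 2 * (x' c * w c) = 2 * C U' T := by
    rw [← Finset.mul_sum]
  have stepB : ∑ c ∈ slice U', x' (S.g i * c) * w c =
      ∑ V ∈ T.powerset, (∏ l ∈ T \ V, (-v l)) * C U' V := by
    rw [step2a]
    simp only [hwg', Finset.mul_sum]
    rw [Finset.sum_comm]
    refine Finset.sum_congr rfl fun V _ => ?_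
    rw [hCV, Finset.mul_sum]
    refine Finset.sum_congr rfl fun c _ => ?_
    ring
  have stepC : ∑ c ∈ slice U', x' ((S.g i)⁻¹ * c) * w c =
      ∑ V ∈ T.powerset, (∏ l ∈ T \ V, v l) * C U' V := by
    rw [step2b]
    simp only [hwg, Finset.mul_sum]
    rw [Finset.sum_comm]
    refine Finset.sum_congr rfl fun V _ => ?_
    rw [hCV, Finset.mul_sum]
    refine Finset.sum_congr rfl fun c _ => ?_
    ring
  have step3 : C U T = 2 * C U' T
      - ∑ V ∈ T.powerset, (∏ l ∈ T \ V, (-v l)) * C U' V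
      - ∑ V ∈ T.powerset, (∏ l ∈ T \ V, v l) * C U' V := by
    rw [step1]
    have : ∀ c ∈ slice U', (2 * x' c - x' (S.g i * c) - x' ((S.g i)⁻¹ * c)) * w c =
        2 * (x' c * w c) - x' (S.g i * c) * w c - x' ((S.g i)⁻¹ * c) * w c := fun c _ => by ring
    rw [Finset.sum_congr rfl this, Finset.sum_sub_distrib, Finset.sum_sub_distrib, stepA, stepB, stepC]
  rw [step3]
  -- split off V = T in both sums: the main terms cancel, 2 − 1 − 1 = 0
  have hTp : T ∈ T.powerset := Finset.mem_powerset_self T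
  rw [← Finset.add_sum_erase _ _ hTp, ← Finset.add_sum_erase _ _ hTp]
  simp only [Finset.sdiff_self, Finset.prod_empty, one_mul]
  -- the V ⊊ T terms vanish by induction (V ⊊ T ⊆ U')
  have hrest : ∀ (u : ι → B),
      ∑ V ∈ T.powerset.erase T, (∏ l ∈ T \ V, u l) * C U' V = 0 := by
    intro u
    refine Finset.sum_eq_zero fun V hV => ?_
    obtain ⟨hVT, hVp⟩ := Finset.mem_erase.1 hV
    have hVss : V ⊂ T := Finset.ssubset_iff_subset_ne.2 ⟨Finset.mem_powerset.1 hVp, hVT⟩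
    have hVU' : V ⊂ U' := Finset.ssubset_of_ssubset_of_subset hVss hTU'
    rw [ih (n - 1) (by omega) U' V hcard hVU', mul_zero]
  have hrest1 : ∑ V ∈ T.powerset.erase T, (∏ l ∈ T \ V, (-v l)) * C U' V = 0 := hrest _
  have hrest2 : ∑ V ∈ T.powerset.erase T, (∏ l ∈ T \ V, v l) * C U' V = 0 := hrest _
  rw [hrest1, hrest2]
  ring

/-- At the full level: `Σ_{a} x_univ(a)·Π_{l∈T} L_l(a_l) = 0` for every `T ≠ univ`. [folklore] -/
theorem sum_x_univ_mul_prod_eq_zero (T : Finset ι) (hT : T ≠ Finset.univ) :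
    ∑ a : Π i, G i, S.x Finset.univ a * ∏ l ∈ T, Multiplicative.toAdd (L l (a l)) = 0 := by
  have hslice : slice (G := G) (Finset.univ : Finset ι) = Finset.univ := by
    ext a; simp [mem_slice]
  have h := sum_slice_mul_prod_eq_zero_of_ssubset S L Finset.univ T
    (Finset.ssubset_iff_subset_ne.2 ⟨Finset.subset_univ T, hT⟩)
  rwa [hslice] at h

end Additive

/-! ### The rational plus symbol: lower Taylor coefficients of `θ̃` vanish (CRT coordinates, then `(ℤ/n)ˣ`) -/

section Symbol

open Literature.NumberTheory.DiophantineGeometry.Dioph (ratModP)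

variable {ι : Type*} [Fintype ι] [DecidableEq ι] (ℓ : ι → ℕ) [hℓ : ∀ i, Fact (ℓ i).Prime]
  (hinj : Function.Injective ℓ) (P : ℚ → ℚ) (hper : ∀ (r : ℚ) (z : ℤ), P (r + z) = P r)
  {p : ℕ} [hp : Fact p.Prime] (k : ℕ) (A : ι → ℤ)
  (hhecke : ∀ (i : ι) (r : ℚ), (A i : ℚ) * P r =
    ∑ j : Fin (ℓ i), P ((r + ((j : ℕ) : ℚ)) / (ℓ i : ℚ)) + P ((ℓ i : ℚ) * r))
  (hA : ∀ i, ((A i : ℤ) : ZMod (p ^ k)) = 2)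
  (hint : ∀ (U : Finset ι) (a : Π i, (ZMod (ℓ i))ˣ), ‖((P (levelArg ℓ U a) : ℚ) : ℚ_[p])‖ ≤ 1)

include hinj hper hhecke hA hint in
/-- **Lower Taylor coefficients of `P` at the full level vanish** (CRT coordinates): for `T ≠ univ` and
additive characters `ψ_i : (ℤ/ℓ_i)ˣ → ℤ/p^k`,
`Σ_a \overline{P(levelArg a)} · Π_{i∈T} ψ_i(a_i) = 0` in `ℤ/p^k`. [folklore] -/
theorem sum_ratModP_levelArg_mul_prod_eq_zero (ψ : Π i, (ZMod (ℓ i))ˣ →* Multiplicative (ZMod (p ^ k)))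
    (T : Finset ι) (hT : T ≠ Finset.univ) :
    ∑ a : Π i, (ZMod (ℓ i))ˣ, ratModP (p ^ k) (P (levelArg ℓ Finset.univ a)) *
        ∏ i ∈ T, Multiplicative.toAdd (ψ i (a i)) = 0 := by
  have h := sum_x_univ_mul_prod_eq_zero (symbolDist ℓ hinj P hper k A hhecke hA hint) ψ T hT
  simp only [symbolDist_x] at h
  exact h

include hinj hper hhecke hA hint in
/-- **… transported to `(ℤ/n)ˣ`** (`n = Π_i ℓ_i`): `Σ_{a ∈ (ℤ/n)ˣ} \overline{P(a/n)} · Π_{i∈T} ψ_i(a mod ℓ_i) = 0`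
for `T ≠ univ`. [folklore] -/
theorem sum_units_ratModP_mul_prod_eq_zero {n : ℕ} [NeZero n] (hn : ∏ i, ℓ i = n)
    (ψ : Π i, (ZMod (ℓ i))ˣ →* Multiplicative (ZMod (p ^ k))) (T : Finset ι) (hT : T ≠ Finset.univ) :
    ∑ a : (ZMod n)ˣ, ratModP (p ^ k) (P ((((a : ZMod n).val : ℕ) : ℚ) / (n : ℚ))) *
        ∏ i ∈ T, Multiplicative.toAdd (ψ i (ZMod.unitsMap (dvd_of_prod_eq ℓ hn i) a)) = 0 := by
  have h := sum_ratModP_levelArg_mul_prod_eq_zero ℓ hinj P hper k A hhecke hA hint ψ T hT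
  have hL : ∑ a : (ZMod n)ˣ, ratModP (p ^ k) (P ((((a : ZMod n).val : ℕ) : ℚ) / (n : ℚ))) *
        ∏ i ∈ T, Multiplicative.toAdd (ψ i (ZMod.unitsMap (dvd_of_prod_eq ℓ hn i) a)) =
      ∑ b : Π i, (ZMod (ℓ i))ˣ, ratModP (p ^ k) (P (levelArg ℓ Finset.univ b)) *
        ∏ i ∈ T, Multiplicative.toAdd (ψ i (b i)) :=
    Fintype.sum_equiv (unitsEquivPi ℓ hinj n hn).toEquiv _ _ fun a => by
      simp only [MulEquiv.toEquiv_eq_coe, MulEquiv.coe_toEquiv, unitsEquivPi_apply,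
        apply_levelArg_unitsEquivPi ℓ hinj P hper hn]
  rw [hL]
  exact h

end Symbol

/-! ### The newform of `E` at a Kolyvagin level: `hlow` for the tree's `MazurTate.taylorCoeff` -/

section Newform

open Literature.NumberTheory.DiophantineGeometry.Dioph (ratModP)
open Literature.NumberTheory.EllipticCurves Literature.NumberTheory.EllipticCurves.ModularForms
open Literature.NumberTheory.EllipticCurves.MazurTate
open CongruenceSubgroup
open scoped MatrixGroups ModularForm

variable {N : ℕ} [NeZero N] (f : CuspForm (Gamma0 N) 2) {p : ℕ} [hp : Fact p.Prime] (k : ℕ)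

/-- **`hlow` for any `f` with the Hecke relation (eigenvalues `≡ 2`) and `p`-integral symbols at the
divisors of a square-free `n`**: every PROPER Taylor coefficient of a `p`-integral structure `Θ` of
`θ̃_f(n)` vanishes in `ℤ/p^k`. [folklore] -/
theorem taylorCoeff_padicLift_eq_zero_of_ssubset {n : ℕ} [NeZero n] (hsq : Squarefree n)
    (A : ℕ → ℤ)
    (hhecke : ∀ ℓ ∈ n.primeFactors, ∀ r : ℚ, (A ℓ : ℚ) * ratPlusSymbol f r =
      ∑ j : Fin ℓ, ratPlusSymbol f ((r + ((j : ℕ) : ℚ)) / (ℓ : ℚ)) + ratPlusSymbol f ((ℓ : ℚ) * r))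
    (hA : ∀ ℓ ∈ n.primeFactors, ((A ℓ : ℤ) : ZMod (p ^ k)) = 2)
    (hint : ∀ d : ℕ, d ∣ n → ∀ z : ℤ, ‖((ratPlusSymbol f ((z : ℚ) / (d : ℚ)) : ℚ) : ℚ_[p])‖ ≤ 1)
    (ψ : (ℓ : ℕ) → (ZMod ℓ)ˣ →* Multiplicative (ZMod (p ^ k)))
    {Θ : MonoidAlgebra ℤ_[p] (ZMod n)ˣ}
    (hΘ : ∀ a : (ZMod n)ˣ, ((Θ.coeff a : ℤ_[p]) : ℚ_[p]) =
      ((ratPlusSymbol f (((a : ZMod n).val : ℚ) / n) : ℚ) : ℚ_[p]))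
    (T : Finset n.primeFactors) (hT : T ⊂ Finset.univ) :
    taylorCoeff (PadicInt.toZModPow k)
        (fun ℓ : n.primeFactors =>
          (ψ ℓ.1).comp (ZMod.unitsMap (Nat.dvd_of_mem_primeFactors ℓ.2))) T Θ = 0 := by
  classical
  haveI hF : ∀ i : ↥n.primeFactors, Fact ((i : ℕ)).Prime :=
    fun i => ⟨Nat.prime_of_mem_primeFactors i.2⟩
  have hn : ∏ i : ↥n.primeFactors, (i : ℕ) = n :=
    (Finset.prod_coe_sort n.primeFactors (fun x : ℕ => x)).trans (Nat.prod_primeFactors_of_squarefree hsq)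
  -- the abstract vanishing on `(ℤ/n)ˣ`
  have h := sum_units_ratModP_mul_prod_eq_zero (ι := ↥n.primeFactors) (fun i => (i : ℕ))
    Subtype.val_injective (ratPlusSymbol f) (fun r z => ratPlusSymbol_add_intCast_eq f r z) k
    (fun i => A i) (fun i r => hhecke i i.2 r) (fun i => hA i i.2)
    (fun U b => by
      rw [levelArg_eq_crtInt_div]
      refine hint (levelOf (fun i : ↥n.primeFactors => (i : ℕ)) U) ?_ _
      have h2 : levelOf (fun i : ↥n.primeFactors => (i : ℕ)) U ∣ ∏ i : ↥n.primeFactors, (i : ℕ) :=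
        Finset.prod_dvd_prod_of_subset _ _ (fun i : ↥n.primeFactors => (i : ℕ)) (Finset.subset_univ U)
      exact h2.trans (dvd_of_eq hn))
    hn (fun i => ψ i) T hT.ne
  -- expand the Taylor coefficient of `Θ = ∑_a Θ_a δ_a`
  have hΘsum : Θ = ∑ a : (ZMod n)ˣ, MonoidAlgebra.single a (Θ.coeff a) := by
    conv_lhs => rw [← MonoidAlgebra.sum_coeff_single Θ]
    rw [Finsupp.sum_fintype]
    intro a
    simp
  rw [hΘsum, map_sum]
  refine Eq.trans (Finset.sum_congr rfl fun a _ => ?_) h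
  rw [taylorCoeff_single]
  have hden : ¬ p ∣ (ratPlusSymbol f (((a : ZMod n).val : ℚ) / n)).den := by
    refine not_dvd_den_of_norm_ratCast_le_one ?_
    rw [← hΘ a]
    exact PadicInt.norm_le_one _
  have hcoeff : PadicInt.toZModPow k (Θ.coeff a) =
      ratModP (p ^ k) (ratPlusSymbol f (((a : ZMod n).val : ℚ) / n)) := by
    rw [ratModP_eq_toZModPow p k hden]
    congr 1
    exact PadicInt.ext (hΘ a)
  rw [hcoeff]
  rfl

variable {W : WeierstrassCurve ℚ} [W.IsElliptic] [W.IsGloballyMinimal]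

/-- **`hlow` FOR THE NEWFORM OF `E` AT A KOLYVAGIN LEVEL** (`n ∈ 𝒩_k(E, p)`, `p` odd, `E[p]` irreducible):
every PROPER Taylor coefficient of the `p`-integral structure `Θ` of `θ̃_f(n)` vanishes in `ℤ/p^k` —
Kim 2022 §3.5's displayed congruence `θ_{ℚ(μ_n)} ≡ δ̃_n·∏(σ_{η_ℓ} − 1)`, lower terms, from the Hecke
relation `Identity.hecke_ratPlusSymbol_of_isNewformOf`, `a_ℓ ≡ 2 (mod p^k)`
(`Identity.frobeniusTrace_cast_eq_two`) and `p`-integrality `IsNewformOf.norm_ratPlusSymbol_div_le_one`.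
This is the `hlow` binder of `GaloisImage/MazurTateTaylorCoeffTwist.lean` (R1-63); END-m2 record consumers
(`ψ` mod `9` at `n ∈ 𝒩₃(E, 3)`) feed `hn.mono (by norm_num) : Kato.IsKolyvaginProduct W 3 2 n`.
[cite: Kim2022StructureSelmer, §3.5 (PDF p. 19)] [cite: Ota2018, Prop. 2.3 (1) and Prop. 3.3] -/
theorem taylorCoeff_padicLift_eq_zero_of_ssubset_of_isNewformOf (hf : IsNewformOf W f)
    (hp2 : p ≠ 2) (hirr : W.HasIrreducibleModPGaloisRep p) {n : ℕ} [NeZero n]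
    (hn : Kato.IsKolyvaginProduct W p k n)
    (ψ : (ℓ : ℕ) → (ZMod ℓ)ˣ →* Multiplicative (ZMod (p ^ k)))
    {Θ : MonoidAlgebra ℤ_[p] (ZMod n)ˣ}
    (hΘ : ∀ a : (ZMod n)ˣ, ((Θ.coeff a : ℤ_[p]) : ℚ_[p]) =
      ((ratPlusSymbol f (((a : ZMod n).val : ℚ) / n) : ℚ) : ℚ_[p]))
    (T : Finset n.primeFactors) (hT : T ⊂ Finset.univ) :
    taylorCoeff (PadicInt.toZModPow k)
        (fun ℓ : n.primeFactors =>
          (ψ ℓ.1).comp (ZMod.unitsMap (Nat.dvd_of_mem_primeFactors ℓ.2))) T Θ = 0 := by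
  have hgood : ∀ ℓ ∈ n.primeFactors, ∀ [Fact ℓ.Prime], W.HasGoodReductionAtPrime ℓ :=
    fun ℓ hℓ _ => hasGoodReductionAtPrime_of_not_dvd_conductorNorm W
      (hn.isKolyvaginPrime (Nat.prime_of_mem_primeFactors hℓ) (Nat.dvd_of_mem_primeFactors hℓ)).not_dvd_conductorNorm
  have hcop : Nat.Coprime n N := Nat.coprime_of_dvd fun ℓ hℓp hℓn hℓN => by
    haveI : Fact ℓ.Prime := ⟨hℓp⟩
    have hmem : ℓ ∈ n.primeFactors := Nat.mem_primeFactors.mpr ⟨hℓp, hℓn, NeZero.ne n⟩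
    exact not_dvd_level_of_isNewformOf hf (hgood ℓ hmem) hℓN
  refine taylorCoeff_padicLift_eq_zero_of_ssubset f k hn.squarefree (fun ℓ => W.frobeniusTrace ℓ)
    (fun ℓ hℓ r => ?_) (fun ℓ hℓ => frobeniusTrace_cast_eq_two k (hn.isKolyvaginPrime
      (Nat.prime_of_mem_primeFactors hℓ) (Nat.dvd_of_mem_primeFactors hℓ)))
    (fun d hd z => hf.norm_ratPlusSymbol_div_le_one hp2 hirr (hcop.coprime_dvd_left hd) z) ψ hΘ T hT
  haveI : Fact ℓ.Prime := ⟨Nat.prime_of_mem_primeFactors hℓ⟩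
  exact hecke_ratPlusSymbol_of_isNewformOf hf (hgood ℓ hℓ) r

/-- **THE TWIST STEP OF F-e, `hlow`-FREE** (r1 §37 (F-e) + this file): for the newform `f` of `E`, `p` odd,
`E[p]` irreducible, `n ∈ 𝒩_k(E, p)`, a `p`-integral structure `Θ` of `θ̃_f(n)` and ANY `x ∈ ℤ_p[(ℤ/n)ˣ]`,
the top Taylor coefficient of `x * Θ` is `ε(x) · δ̃_n` in `ℤ/p^k` — n1011-p06's R1-63
`GaloisImage.taylorCoeff_univ_mul_padicLift_eq_augmentation_mul_kuriharaNumber` (the twist lemma) with its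
`hlow` binder DISCHARGED by `taylorCoeff_padicLift_eq_zero_of_ssubset_of_isNewformOf`. [folklore] -/
theorem taylorCoeff_univ_mul_padicLift_eq_of_isNewformOf (hf : IsNewformOf W f)
    (hp2 : p ≠ 2) (hirr : W.HasIrreducibleModPGaloisRep p) {n : ℕ} [NeZero n]
    (hn : Kato.IsKolyvaginProduct W p k n)
    (ψ : (ℓ : ℕ) → (ZMod ℓ)ˣ →* Multiplicative (ZMod (p ^ k)))
    {Θ : MonoidAlgebra ℤ_[p] (ZMod n)ˣ}
    (hΘ : ∀ a : (ZMod n)ˣ, ((Θ.coeff a : ℤ_[p]) : ℚ_[p]) =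
      ((ratPlusSymbol f (((a : ZMod n).val : ℚ) / n) : ℚ) : ℚ_[p]))
    (x : MonoidAlgebra ℤ_[p] (ZMod n)ˣ) :
    taylorCoeff (PadicInt.toZModPow k)
        (fun ℓ : n.primeFactors =>
          (ψ ℓ.1).comp (ZMod.unitsMap (Nat.dvd_of_mem_primeFactors ℓ.2)))
        Finset.univ (x * Θ) =
      PadicInt.toZModPow k (augmentation ℤ_[p] (ZMod n)ˣ x) * kuriharaNumber f (p ^ k) n ψ :=
  GaloisImage.taylorCoeff_univ_mul_padicLift_eq_augmentation_mul_kuriharaNumber f p k n ψ hΘ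
    (fun T hT => taylorCoeff_padicLift_eq_zero_of_ssubset_of_isNewformOf f k hf hp2 hirr hn ψ hΘ T hT) x

/-- … hence, for a UNIT augmentation, `c_univ(x * Θ) = 0 ↔ δ̃_n = 0`: unit / non-unit certificates on
Kurihara numbers transfer verbatim to the values of ANY unit-augmentation twist of the modular element
(the form END consumers of r1 §37.2 use). [folklore] -/
theorem taylorCoeff_univ_mul_padicLift_eq_zero_iff_of_isNewformOf (hf : IsNewformOf W f)
    (hp2 : p ≠ 2) (hirr : W.HasIrreducibleModPGaloisRep p) {n : ℕ} [NeZero n]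
    (hn : Kato.IsKolyvaginProduct W p k n)
    (ψ : (ℓ : ℕ) → (ZMod ℓ)ˣ →* Multiplicative (ZMod (p ^ k)))
    {Θ : MonoidAlgebra ℤ_[p] (ZMod n)ˣ}
    (hΘ : ∀ a : (ZMod n)ˣ, ((Θ.coeff a : ℤ_[p]) : ℚ_[p]) =
      ((ratPlusSymbol f (((a : ZMod n).val : ℚ) / n) : ℚ) : ℚ_[p]))
    {x : MonoidAlgebra ℤ_[p] (ZMod n)ˣ}
    (hu : IsUnit (PadicInt.toZModPow k (augmentation ℤ_[p] (ZMod n)ˣ x))) :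
    taylorCoeff (PadicInt.toZModPow k)
        (fun ℓ : n.primeFactors =>
          (ψ ℓ.1).comp (ZMod.unitsMap (Nat.dvd_of_mem_primeFactors ℓ.2)))
        Finset.univ (x * Θ) = 0 ↔ kuriharaNumber f (p ^ k) n ψ = 0 := by
  rw [taylorCoeff_univ_mul_padicLift_eq_of_isNewformOf f k hf hp2 hirr hn ψ hΘ x]
  exact hu.mul_right_eq_zero

end Newform

end Summit.BirchSwinnertonDyer.Rank1Residual.Supersingular.KuriharaTwist.Identity
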